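import Summits.QuantumFields.YangMills.Theses.LangevinControlUV

/-!
# `FemtoCurvatureTwoPoint` (stmt-QuantumFields-9363) follows from `FemtoCurvatureTwoPointC` (stmt-QuantumFields-16204)

Route `LangevinControlUV` (sub-problem `YangMills` of summit `QuantumFields`). On 2026-08-16 the
planner repaired the route's deciding crux to CONTINUOUS intrinsic units (repair C′): the tier-deciding
crux is now `FemtoCurvatureTwoPointC` (stmt-QuantumFields-16204), whose body is *verbatim* the body of
the typed predecessor `FemtoCurvatureTwoPoint` (stmt-QuantumFields-9363) with `Continuous a ∧`
inserted after `∃ (a : ℝ → ℝ),`. The typed item was kept in the route file as a SUPPORT edge (the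
necessary fixed-torus edge of the crux, cf. `Cruxes/FemtoCurvatureTwoPoint/Disproof.lean`,
`PackageWith.esfb`).

This file records the edge formally: forgetting continuity of the unit map, every witness of the
C′ crux is a witness of the typed item. Hence stmt-9363 closes the moment stmt-16204 does; the file is
a helper (`--supports stmt-QuantumFields-9363`), not a proof of the item, which stays open.

Deliberately NOT here: any fixed-torus semiclassics (the honest residue of the typed item,
`SemiclassicalLimits` / `AxisGaussianDomination ∧ DiagUpperRestOdd` of line generic-step-gamma-encoding)
and anything about the C′ crux itself.
-/

namespace Summit.QuantumFields.YangMills.Theorems.FemtoCurvatureTwoPoint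

open Summit.QuantumFields.YangMills.Theses.LangevinControlUV

/-- **The C′ edge.** The deciding crux in continuous intrinsic units,
`FemtoCurvatureTwoPointC` (stmt-QuantumFields-16204), implies the typed support item
`FemtoCurvatureTwoPoint` (stmt-QuantumFields-9363): the two bodies agree verbatim except for the
extra conjunct `Continuous a`, which is simply dropped. [folklore] -/
theorem femtoCurvatureTwoPoint_of_C (hC : FemtoCurvatureTwoPointC) : FemtoCurvatureTwoPoint := by
  unfold FemtoCurvatureTwoPoint
  unfold FemtoCurvatureTwoPointC at hC
  intro G _ _ _ _ hG r
  obtain ⟨a, -, h⟩ := hC G hG r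
  exact ⟨a, h⟩

end Summit.QuantumFields.YangMills.Theorems.FemtoCurvatureTwoPoint
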